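import Mathlib.Topology.UniformSpace.HeineCantor
import Literature.Analysis.FunctionSpaces.MaximalLipschitz
import Literature.Analysis.FunctionSpaces.MollifySmooth
import HarnessLib

/-!
# The smooth Lipschitz truncation of a `C¹_c` function at height `λ` of `M(‖Du‖)`

Let `u ∈ C¹_c(E; ℝ)` on a finite-dimensional real normed space `E` (dimension `n`, additive
Haar measure `μ`), `M = M_μ(‖Du‖)` the centred maximal function of `‖Du‖`, `λ > 0`,
`E_λ = {M ≤ λ}`. By `Literature.Analysis.FunctionSpaces.lipschitzOnWith_of_maximal_le`, `u` is
`L = 2²ⁿ⁺⁶λ`-Lipschitz on `E_λ`; let `g` be its McShane extension (Mathlib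
`LipschitzOnWith.extend_real`). Since `M → 0` at infinity, `{λ < M}` is bounded and `g` has
compact support. Mollifying at scale `ε` gives the smooth decomposition
`ρ_ε ⋆ u = g_ε + b_ε`, `g_ε = ρ_ε ⋆ g`, `b_ε = ρ_ε ⋆ (u - g)` with

* `‖Dg_ε‖ ≤ L` everywhere, `‖Db_ε‖ ≤ 2ⁿ M + L` everywhere;
* off the enlarged bad set `{λ/2ⁿ⁺¹ < M}` (for `ε ≤ ε₀(u, λ)`): `Db_ε = 0`, `‖Dg_ε‖ ≤ 2ⁿ M` and
  `M ≤ λ`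

(`exists_smooth_lipschitz_truncation`). The enlargement absorbs the `2ε`-neighbourhood of
`{λ < M}` needed for the locality of mollification; it uses the uniform continuity of `Du`.
This is the smooth form of the Calderón–Zygmund decomposition of Sobolev functions
[Badr2009, §5 Prop. 5.6] used to interpolate gradient `Lᵖ` bounds by the real method.

## References

* [Badr2009] N. Badr, *Real interpolation of Sobolev spaces*, Math. Scand. 105 (2009), §5,
  Prop. 5.6 and Thm 5.5 / Cor. 5.9.
-/

noncomputable section

open MeasureTheory Metric Set Filter Topology Module
open scoped ENNReal NNReal ContDiff

namespace Literature.Analysis.FunctionSpaces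

open Literature.Analysis.SingularIntegrals

universe u

variable {E : Type u} [NormedAddCommGroup E] [NormedSpace ℝ E] [FiniteDimensional ℝ E]
  [MeasurableSpace E] [BorelSpace E] (μ : Measure E) [μ.IsAddHaarMeasure]

/-! ### Continuous sizes lie below their maximal function -/

/-- `F(x) ≤ M(F)(x)` for a continuous size `F`. [folklore] -/
theorem le_maximalFunction_of_continuous {F : E → ℝ≥0∞} (hF : Continuous F) (x : E) :
    F x ≤ maximalFunction μ F x := by
  refine le_of_forall_lt_imp_le_of_dense fun c hc => ?_
  -- `c < F` on a ball around `x`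
  have hopen : IsOpen {y | c < F y} := isOpen_lt continuous_const hF
  obtain ⟨r, hr, hball⟩ := Metric.isOpen_iff.1 hopen x hc
  have hB0 : μ (ball x r) ≠ 0 := (measure_ball_pos μ x hr).ne'
  have hBt : μ (ball x r) ≠ ⊤ := measure_ball_lt_top.ne
  calc c = (μ (ball x r))⁻¹ * ∫⁻ _y in ball x r, c ∂μ := by
        rw [setLIntegral_const, mul_comm c, ← mul_assoc, ENNReal.inv_mul_cancel hB0 hBt, one_mul]
    _ ≤ (μ (ball x r))⁻¹ * ∫⁻ y in ball x r, F y ∂μ :=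
        mul_le_mul_right (setLIntegral_mono' measurableSet_ball fun y hy => (hball hy).le) _
    _ ≤ maximalFunction μ F x := average_le_maximalFunction μ F x hr

/-! ### Decay of the maximal function of a compactly supported size -/

omit [NormedSpace ℝ E] [FiniteDimensional ℝ E] in
/-- If the size `F` vanishes outside `B̄(0, R)` and has integral `I`, then
`M(F)(x) ≤ I · μ(B(0, ‖x‖ - R))⁻¹` (of interest for `‖x‖ > R`). [folklore] -/
theorem maximalFunction_le_of_support_subset {F : E → ℝ≥0∞} {R : ℝ}
    (hFR : ∀ y, R < ‖y‖ → F y = 0) (x : E) :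
    maximalFunction μ F x ≤ (∫⁻ y, F y ∂μ) * (μ (ball (0 : E) (‖x‖ - R)))⁻¹ := by
  refine iSup₂_le fun r hr => ?_
  rcases le_or_gt r (‖x‖ - R) with hle | hgt
  · -- the ball misses the support
    have hzero : ∫⁻ y in ball x r, F y ∂μ = 0 := by
      rw [setLIntegral_congr_fun measurableSet_ball fun y hy => hFR y ?_, lintegral_zero]
      rw [mem_ball, dist_eq_norm] at hy
      have : ‖x‖ - ‖y‖ ≤ ‖y - x‖ := by
        rw [norm_sub_rev]; exact (abs_norm_sub_norm_le x y).trans' (le_abs_self _)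
      linarith
    rw [hzero, mul_zero]
    exact zero_le
  · calc (μ (ball x r))⁻¹ * ∫⁻ y in ball x r, F y ∂μ
        ≤ (μ (ball x (‖x‖ - R)))⁻¹ * ∫⁻ y, F y ∂μ :=
          mul_le_mul' (ENNReal.inv_le_inv.2 (measure_mono (ball_subset_ball hgt.le)))
            (setLIntegral_le_lintegral _ _)
      _ = (∫⁻ y, F y ∂μ) * (μ (ball (0 : E) (‖x‖ - R)))⁻¹ := by
          rw [Measure.addHaar_ball_center, mul_comm]

/-- **The bad set is bounded**: for a continuous compactly supported map `G` and `λ > 0`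
there is `R₁` with `M(‖G‖)(x) ≤ λ` whenever `‖x‖ ≥ R₁`. [folklore] -/
theorem exists_maximalFunction_le_of_norm_ge {G' : Type*} [NormedAddCommGroup G'] {G : E → G'}
    (hG : Continuous G) (hcG : HasCompactSupport G) {l : ℝ≥0∞} (hl : 0 < l) :
    ∃ R₁ : ℝ, ∀ x, R₁ ≤ ‖x‖ → maximalFunction μ (fun w => ‖G w‖ₑ) x ≤ l := by
  rcases eq_or_ne l ⊤ with rfl | hlt
  · exact ⟨0, fun x _ => le_top⟩
  rcases subsingleton_or_nontrivial E with hE | hE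
  · refine ⟨1, fun x hx => ?_⟩
    have : x = 0 := Subsingleton.elim x 0
    rw [this, norm_zero] at hx
    exact absurd hx (by norm_num)
  -- support in `B̄(0, R)`, finite integral `I`
  obtain ⟨R, hR0, hR⟩ := hcG.isCompact.isBounded.subset_closedBall_lt 0 0
  have hFR : ∀ y, R < ‖y‖ → ‖G y‖ₑ = 0 := fun y hy => by
    rw [enorm_eq_zero]
    refine image_eq_zero_of_notMem_tsupport fun h => ?_
    have := hR h
    rw [mem_closedBall, dist_zero_right] at this
    linarith
  set I := ∫⁻ y, ‖G y‖ₑ ∂μ with hI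
  have hIt : I ≠ ⊤ := (hG.integrable_of_hasCompactSupport hcG).2.ne
  set V₁ := μ (ball (0 : E) 1) with hV₁
  have hV0 : V₁ ≠ 0 := (measure_ball_pos μ 0 one_pos).ne'
  have hVt : V₁ ≠ ⊤ := measure_ball_lt_top.ne
  have hlV0 : l * V₁ ≠ 0 := mul_ne_zero hl.ne' hV0
  have hlVt : l * V₁ ≠ ⊤ := ENNReal.mul_ne_top hlt hVt
  -- the radius
  set s₀ : ℝ := (I / (l * V₁)).toReal + 1 with hs₀
  have hs₀1 : 1 ≤ max 1 s₀ := le_max_left _ _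
  refine ⟨R + max 1 s₀, fun x hx => ?_⟩
  have hs1 : 1 ≤ ‖x‖ - R := by linarith [le_max_left 1 s₀]
  have hss₀ : s₀ ≤ ‖x‖ - R := by linarith [le_max_right 1 s₀]
  refine (maximalFunction_le_of_support_subset μ hFR x).trans ?_
  -- `μ(B(0, ‖x‖ - R)) ≥ (‖x‖ - R) V₁ ≥ s₀ V₁`
  have hball : ENNReal.ofReal s₀ * V₁ ≤ μ (ball (0 : E) (‖x‖ - R)) := by
    rw [hV₁, Measure.addHaar_ball_of_pos μ 0 (by linarith : 0 < ‖x‖ - R)]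
    refine mul_le_mul_left (ENNReal.ofReal_le_ofReal (hss₀.trans ?_)) _
    calc ‖x‖ - R = (‖x‖ - R) ^ 1 := (pow_one _).symm
      _ ≤ (‖x‖ - R) ^ finrank ℝ E := pow_le_pow_right₀ hs1 Module.finrank_pos
  have hs₀I : I / (l * V₁) ≤ ENNReal.ofReal s₀ := by
    rw [hs₀]
    calc I / (l * V₁) = ENNReal.ofReal (I / (l * V₁)).toReal :=
          (ENNReal.ofReal_toReal (ENNReal.div_ne_top hIt hlV0)).symm
      _ ≤ ENNReal.ofReal ((I / (l * V₁)).toReal + 1) := ENNReal.ofReal_le_ofReal (by linarith)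
  calc I * (μ (ball (0 : E) (‖x‖ - R)))⁻¹
      ≤ I * (ENNReal.ofReal s₀ * V₁)⁻¹ := mul_le_mul_right (ENNReal.inv_le_inv.2 hball) _
    _ ≤ I * (I / (l * V₁) * V₁)⁻¹ :=
        mul_le_mul_right (ENNReal.inv_le_inv.2 (mul_le_mul_left hs₀I _)) _
    _ ≤ l := by
        rcases eq_or_ne I 0 with hI0 | hI0
        · rw [hI0, zero_mul]; exact zero_le
        have hkey : I / (l * V₁) * V₁ = I / l := by
          rw [div_eq_mul_inv, div_eq_mul_inv, ENNReal.mul_inv (Or.inl hl.ne') (Or.inl hlt),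
            mul_assoc, mul_assoc, ENNReal.inv_mul_cancel hV0 hVt, mul_one]
        rw [hkey, ENNReal.inv_div (Or.inr hIt) (Or.inr hI0), ENNReal.mul_div_cancel hI0 hIt]

/-! ### The enlarged bad set absorbs a neighbourhood of the bad set -/

/-- If an average of a continuous size over `B(x', r)` exceeds `λ`, some point of the ball has
size `> λ`. [folklore] -/
theorem exists_lt_of_lt_average {F : E → ℝ≥0∞} {x' : E} {r : ℝ} (hr : 0 < r) {l : ℝ≥0∞}
    (h : l < (μ (ball x' r))⁻¹ * ∫⁻ y in ball x' r, F y ∂μ) : ∃ w ∈ ball x' r, l < F w := by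
  by_contra hcon
  simp only [not_exists, not_and, not_lt] at hcon
  have hB0 : μ (ball x' r) ≠ 0 := (measure_ball_pos μ x' hr).ne'
  have hBt : μ (ball x' r) ≠ ⊤ := measure_ball_lt_top.ne
  have : (μ (ball x' r))⁻¹ * ∫⁻ y in ball x' r, F y ∂μ ≤ l := by
    calc (μ (ball x' r))⁻¹ * ∫⁻ y in ball x' r, F y ∂μ
        ≤ (μ (ball x' r))⁻¹ * ∫⁻ _y in ball x' r, l ∂μ :=
          mul_le_mul_right (setLIntegral_mono' measurableSet_ball hcon) _
      _ = l := by
          rw [setLIntegral_const, mul_comm l, ← mul_assoc, ENNReal.inv_mul_cancel hB0 hBt, one_mul]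
  exact (h.trans_le this).false

/-- **Enlargement**: for `u ∈ C¹_c` and `λ > 0` there is `ε₀ > 0` such that every point within
`ε₀` of the bad set `{λ < M(‖Du‖)}` lies in the enlarged bad set `{λ/2ⁿ⁺¹ < M(‖Du‖)}`
(large balls are compared directly, small balls through the uniform continuity of `Du`).
[folklore] -/
theorem exists_radius_bad_subset {u : E → ℝ} (hu : ContDiff ℝ 1 u) (hcu : HasCompactSupport u)
    {l : ℝ≥0} (hl : 0 < l) :
    ∃ ε₀ > 0, ∀ x x' : E, dist x' x < ε₀ →
      (l : ℝ≥0∞) < maximalFunction μ (fun w => ‖fderiv ℝ u w‖ₑ) x' →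
      (l : ℝ≥0∞) / 2 ^ (finrank ℝ E + 1) < maximalFunction μ (fun w => ‖fderiv ℝ u w‖ₑ) x := by
  set n := finrank ℝ E with hn
  set M := maximalFunction μ (fun w => ‖fderiv ℝ u w‖ₑ) with hM
  have hDc : Continuous (fderiv ℝ u) := hu.continuous_fderiv one_ne_zero
  have hDu : UniformContinuous (fderiv ℝ u) :=
    (hcu.fderiv ℝ).uniformContinuous_of_continuous hDc
  obtain ⟨η, hη, hηl⟩ := Metric.uniformContinuous_iff.1 hDu (l / 2) (by positivity)
  refine ⟨η / 2, half_pos hη, fun x x' hxx' hlM => ?_⟩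
  -- `λ/2ⁿ⁺¹ ≤ λ/2ⁿ` and `λ/2ⁿ⁺¹ ≤ λ/2`
  have hl2n : (l : ℝ≥0∞) / 2 ^ (n + 1) ≤ (2 ^ n)⁻¹ * l := by
    rw [div_eq_mul_inv, mul_comm]
    refine mul_le_mul_left (ENNReal.inv_le_inv.2 ?_) _
    exact pow_le_pow_right₀ one_le_two (Nat.le_succ n)
  have hl2 : (l : ℝ≥0∞) / 2 ^ (n + 1) ≤ (l : ℝ≥0∞) / 2 := by
    rw [div_eq_mul_inv, div_eq_mul_inv]
    refine mul_le_mul_right (ENNReal.inv_le_inv.2 ?_) _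
    calc (2 : ℝ≥0∞) = 2 ^ 1 := (pow_one _).symm
      _ ≤ 2 ^ (n + 1) := pow_le_pow_right₀ one_le_two (by omega)
  -- a ball `B(x', r)` with large average
  rw [hM, maximalFunction_def] at hlM
  obtain ⟨r, hlr⟩ := lt_iSup_iff.1 hlM
  obtain ⟨hr, hlr⟩ := lt_iSup_iff.1 hlr
  rcases le_or_gt (η / 2) r with hbig | hsmall
  · -- large ball: compare with `B(x, 2r) ⊇ B(x', r)`
    have hsub : ball x' r ⊆ ball x (2 * r) := fun y hy => by
      rw [mem_ball] at hy ⊢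
      calc dist y x ≤ dist y x' + dist x' x := dist_triangle _ _ _
        _ < r + η / 2 := add_lt_add hy hxx'
        _ ≤ 2 * r := by linarith
    have h2r : 0 < 2 * r := by positivity
    have hscale : (μ (ball x (2 * r)))⁻¹ = (2 ^ n)⁻¹ * (μ (ball x' r))⁻¹ := by
      rw [measure_ball_mul_eq μ x' x two_pos r, ENNReal.ofReal_pow (by norm_num),
        ENNReal.ofReal_ofNat, ENNReal.mul_inv (Or.inl (by simp)) (Or.inl (by simp))]
    calc (l : ℝ≥0∞) / 2 ^ (n + 1) ≤ (2 ^ n)⁻¹ * l := hl2n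
      _ < (2 ^ n)⁻¹ * ((μ (ball x' r))⁻¹ * ∫⁻ y in ball x' r, ‖fderiv ℝ u y‖ₑ ∂μ) :=
          ENNReal.mul_lt_mul_right (by simp) (by simp) hlr
      _ ≤ (2 ^ n)⁻¹ * ((μ (ball x' r))⁻¹ * ∫⁻ y in ball x (2 * r), ‖fderiv ℝ u y‖ₑ ∂μ) :=
          mul_le_mul_right (mul_le_mul_right (lintegral_mono_set hsub) _) _
      _ = (μ (ball x (2 * r)))⁻¹ * ∫⁻ y in ball x (2 * r), ‖fderiv ℝ u y‖ₑ ∂μ := by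
          rw [hscale, mul_assoc]
      _ ≤ M x := average_le_maximalFunction μ _ x h2r
  · -- small ball: a point `w` with `‖Du w‖ > λ` within `η` of `x`
    obtain ⟨w, hw, hlw⟩ := exists_lt_of_lt_average μ hr hlr
    have hwx : dist w x < η := by
      calc dist w x ≤ dist w x' + dist x' x := dist_triangle _ _ _
        _ < r + η / 2 := add_lt_add (mem_ball.1 hw) hxx'
        _ < η / 2 + η / 2 := by linarith
        _ = η := by ring
    have hclose : dist (fderiv ℝ u w) (fderiv ℝ u x) < l / 2 := hηl hwx
    -- `‖Du x‖ > λ/2`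
    have hlw' : (l : ℝ) < ‖fderiv ℝ u w‖ := by
      by_contra hle
      rw [not_lt] at hle
      have : ‖fderiv ℝ u w‖ₑ ≤ (l : ℝ≥0∞) := by
        rw [← ofReal_norm, ← ENNReal.ofReal_coe_nnreal]
        exact ENNReal.ofReal_le_ofReal hle
      exact (hlw.trans_le this).false
    have hx2 : (l : ℝ) / 2 < ‖fderiv ℝ u x‖ := by
      rw [dist_eq_norm] at hclose
      have := norm_sub_norm_le (fderiv ℝ u w) (fderiv ℝ u x)
      linarith
    have hx2' : (l : ℝ≥0∞) / 2 < ‖fderiv ℝ u x‖ₑ := by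
      rw [← ofReal_norm, ← ENNReal.ofReal_coe_nnreal, ← ENNReal.ofReal_ofNat,
        ← ENNReal.ofReal_div_of_pos two_pos]
      have hl' : (0 : ℝ) < l := NNReal.coe_pos.2 hl
      exact (ENNReal.ofReal_lt_ofReal_iff (by linarith)).2 hx2
    calc (l : ℝ≥0∞) / 2 ^ (n + 1) ≤ (l : ℝ≥0∞) / 2 := hl2
      _ < ‖fderiv ℝ u x‖ₑ := hx2'
      _ ≤ M x := le_maximalFunction_of_continuous μ hDc.enorm x

/-! ### The smooth Lipschitz truncation -/

/-- **Smooth Lipschitz truncation at height `λ`.** For `u ∈ C¹_c(E; ℝ)`, `λ > 0`,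
`M = M(‖Du‖)`, `L = 2²ⁿ⁺⁶λ`, there is `ε₀ > 0` such that for every `0 < ε ≤ ε₀` the
mollification `ρ_ε ⋆ u` splits as `g + b` with `g, b ∈ C^∞_c`,
`‖Dg‖ ≤ L` and `‖Db‖ ≤ 2ⁿ M + L` everywhere, and off the enlarged bad set `{λ/2ⁿ⁺¹ < M}`:
`Db = 0`, `‖Dg‖ ≤ 2ⁿ M` and `M ≤ λ` (`g = ρ_ε ⋆ (McShane extension of u|{M ≤ λ})`).
[cite: Badr2009, §5 Prop. 5.6 (smooth variant)] -/
theorem exists_smooth_lipschitz_truncation {u : E → ℝ} (hu : ContDiff ℝ 1 u)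
    (hcu : HasCompactSupport u) {l : ℝ≥0} (hl : 0 < l) :
    ∃ ε₀ > 0, ∀ ε, 0 < ε → ε ≤ ε₀ → ∃ g b : E → ℝ,
      ContDiff ℝ ∞ g ∧ HasCompactSupport g ∧ ContDiff ℝ ∞ b ∧ HasCompactSupport b ∧
      haarMollify μ ε u = g + b ∧
      (∀ x, ‖fderiv ℝ g x‖ₑ ≤ ((2 ^ (2 * finrank ℝ E + 6) * l : ℝ≥0) : ℝ≥0∞)) ∧
      (∀ x, ‖fderiv ℝ b x‖ₑ ≤
        2 ^ finrank ℝ E * maximalFunction μ (fun w => ‖fderiv ℝ u w‖ₑ) x +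
          ((2 ^ (2 * finrank ℝ E + 6) * l : ℝ≥0) : ℝ≥0∞)) ∧
      (∀ x, ¬ ((l : ℝ≥0∞) / 2 ^ (finrank ℝ E + 1) <
          maximalFunction μ (fun w => ‖fderiv ℝ u w‖ₑ) x) →
        fderiv ℝ b x = 0 ∧
        ‖fderiv ℝ g x‖ₑ ≤ 2 ^ finrank ℝ E * maximalFunction μ (fun w => ‖fderiv ℝ u w‖ₑ) x ∧
        maximalFunction μ (fun w => ‖fderiv ℝ u w‖ₑ) x ≤ l) := by
  set n := finrank ℝ E with hn
  set M := maximalFunction μ (fun w => ‖fderiv ℝ u w‖ₑ) with hM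
  set L : ℝ≥0 := 2 ^ (2 * n + 6) * l with hL
  have hDc : Continuous (fderiv ℝ u) := hu.continuous_fderiv one_ne_zero
  -- the Lipschitz extension `g` of `u|{M ≤ λ}`
  have hLip : LipschitzOnWith L u {x | M x ≤ l} := lipschitzOnWith_of_maximal_le μ hu l
  obtain ⟨g, hg, hgu⟩ := hLip.extend_real
  -- `g` has compact support: `{λ < M}` and `supp u` are bounded
  obtain ⟨R₁, hR₁⟩ := exists_maximalFunction_le_of_norm_ge μ hDc (hcu.fderiv ℝ)
    (l := (l : ℝ≥0∞)) (by exact_mod_cast hl)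
  obtain ⟨Ru, -, hRu⟩ := hcu.isCompact.isBounded.subset_closedBall_lt 0 0
  have hgc : HasCompactSupport g := by
    refine HasCompactSupport.intro (isCompact_closedBall (0 : E) (max R₁ Ru)) fun x hx => ?_
    rw [mem_closedBall, dist_zero_right, not_le] at hx
    have hxE : x ∈ {x | M x ≤ l} := hR₁ x (le_of_lt (lt_of_le_of_lt (le_max_left _ _) hx))
    rw [← hgu hxE]
    refine image_eq_zero_of_notMem_tsupport fun h => ?_
    have := hRu h
    rw [mem_closedBall, dist_zero_right] at this
    linarith [le_max_right R₁ Ru]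
  have hgloc : LocallyIntegrable g μ := hg.continuous.locallyIntegrable
  have huloc : LocallyIntegrable u μ := hu.continuous.locallyIntegrable
  -- the radius
  obtain ⟨ε₁, hε₁, hbad⟩ := exists_radius_bad_subset μ hu hcu hl
  refine ⟨ε₁ / 2, half_pos hε₁, fun ε hε hεε => ?_⟩
  -- off the enlarged bad set, `B(x, 2ε) ⊆ {M ≤ λ}`
  have hball : ∀ x, ¬ ((l : ℝ≥0∞) / 2 ^ (n + 1) < M x) → ∀ y ∈ ball x (2 * ε), u y = g y := by
    intro x hx y hy
    refine hgu (show M y ≤ l from ?_)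
    by_contra hy'
    rw [not_le] at hy'
    exact hx (hbad x y ((mem_ball.1 hy).trans_le (by linarith)) hy')
  refine ⟨haarMollify μ ε g, haarMollify μ ε u - haarMollify μ ε g, contDiff_haarMollify μ ε hgloc,
    hasCompactSupport_haarMollify μ ε hgc,
    (contDiff_haarMollify μ ε huloc).sub (contDiff_haarMollify μ ε hgloc),
    (hasCompactSupport_haarMollify μ ε hcu).sub (hasCompactSupport_haarMollify μ ε hgc),
    (add_sub_cancel _ _).symm, fun x => ?_, fun x => ?_, fun x hx => ?_⟩
  · -- `‖Dg_ε‖ ≤ L`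
    rw [← ofReal_norm, ← ENNReal.ofReal_coe_nnreal]
    exact ENNReal.ofReal_le_ofReal (norm_fderiv_haarMollify_le_of_lipschitz μ ε hg x)
  · -- `‖Db_ε‖ ≤ 2ⁿ M + L`
    have hdu : DifferentiableAt ℝ (haarMollify μ ε u) x :=
      ((contDiff_haarMollify μ ε huloc (n := 1)).differentiable one_ne_zero) x
    have hdg : DifferentiableAt ℝ (haarMollify μ ε g) x :=
      ((contDiff_haarMollify μ ε hgloc (n := 1)).differentiable one_ne_zero) x
    rw [fderiv_sub hdu hdg]
    refine (enorm_sub_le).trans (add_le_add (enorm_fderiv_haarMollify_le_maximal μ hε hu hcu x) ?_)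
    rw [← ofReal_norm, ← ENNReal.ofReal_coe_nnreal]
    exact ENNReal.ofReal_le_ofReal (norm_fderiv_haarMollify_le_of_lipschitz μ ε hg x)
  · -- off the enlarged bad set
    have heq : fderiv ℝ (haarMollify μ ε u) x = fderiv ℝ (haarMollify μ ε g) x :=
      fderiv_haarMollify_congr_ball μ hε (hball x hx)
    have hdu : DifferentiableAt ℝ (haarMollify μ ε u) x :=
      ((contDiff_haarMollify μ ε huloc (n := 1)).differentiable one_ne_zero) x
    have hdg : DifferentiableAt ℝ (haarMollify μ ε g) x :=
      ((contDiff_haarMollify μ ε hgloc (n := 1)).differentiable one_ne_zero) x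
    refine ⟨by rw [fderiv_sub hdu hdg, heq, sub_self], ?_, ?_⟩
    · rw [← heq]
      exact enorm_fderiv_haarMollify_le_maximal μ hε hu hcu x
    · rw [not_lt] at hx
      refine hx.trans ?_
      rw [div_eq_mul_inv]
      calc (l : ℝ≥0∞) * (2 ^ (n + 1))⁻¹ ≤ (l : ℝ≥0∞) * 1 :=
            mul_le_mul_right (ENNReal.inv_le_one.2 (one_le_pow₀ one_le_two)) _
        _ = l := mul_one _

end Literature.Analysis.FunctionSpaces

end
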